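import Mathlib

/-!
# SoloBlind — Möbius tube lemma (discrete skeleton of the monotonicity "tube lemma")

For a three-term recurrence `u (k+1) - b k * u k + u (k-1) = 0` the ratios `ρ k = u (k+1) / u k` propagate
backwards through the Möbius maps `ρ (k-1) = (b k - ρ k)⁻¹`, whose fixed point `r k` (the small root of
`r^2 - b r + 1 = 0`) has multiplier `r k ^ 2`.  We prove the one-step disc estimate
`‖(b - ρ)⁻¹ - r‖ ≤ ‖r‖^2 δ / (1 - ‖r‖ δ)` for `‖ρ - r‖ ≤ δ`, the containment step, and the backward induction:
if the discs `D k = D(r k, δ k)` satisfy the chain condition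
`‖r k - r (k-1)‖ + ‖r k‖^2 δ k / (1 - ‖r k‖ δ k) ≤ δ (k-1)` and the seed ratio lies in `D K`, then every ratio
down to `k₀` lies in its disc; with `‖r k‖ + δ k ≤ 1` this gives `‖u (k+1)‖ ≤ ‖u k‖` (monotonicity of the
recessive solution beyond the tube threshold).  Pure algebra/inequalities; the analytic verification of the chain
condition for the Weber-type coefficients is a separate (certified numerical) statement.
-/

namespace Summit.AnomalousDissipation.SoloBlind.MobiusTube

open Complex

/-- Fixed-point form of the characteristic equation: `b - r = r⁻¹`. -/
theorem sub_eq_inv {b r : ℂ} (hr : r ≠ 0) (hfix : r ^ 2 - b * r + 1 = 0) : b - r = r⁻¹ := by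
  have h1 : (b - r) * r = 1 := by linear_combination -hfix
  field_simp
  linear_combination h1

/-- Elementary real inequality: `x ↦ c * x / (1 - x)` is monotone on `(-∞,1)` for `c ≥ 0`. -/
theorem div_one_sub_mono {x y c : ℝ} (hc : 0 ≤ c) (hxy : x ≤ y) (hy1 : y < 1) :
    c * x / (1 - x) ≤ c * y / (1 - y) := by
  have hx1 : x < 1 := lt_of_le_of_lt hxy hy1
  rw [div_le_div_iff₀ (by linarith) (by linarith)]
  nlinarith [mul_nonneg hc (sub_nonneg.mpr hxy)]

/-- One Möbius step: the image of the disc `D(r, δ)` under `ρ ↦ (b - ρ)⁻¹` lies in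
`D(r, ‖r‖² δ / (1 - ‖r‖ δ))`, provided `‖r‖ δ < 1`. -/
theorem mobius_step {b r ρ : ℂ} {δ : ℝ} (hr : r ≠ 0) (hfix : r ^ 2 - b * r + 1 = 0)
    (hρ : ‖ρ - r‖ ≤ δ) (hqδ : ‖r‖ * δ < 1) :
    b - ρ ≠ 0 ∧ ‖(b - ρ)⁻¹ - r‖ ≤ ‖r‖ ^ 2 * δ / (1 - ‖r‖ * δ) := by
  set w : ℂ := r * (ρ - r) with hw_def
  have hδ0 : 0 ≤ δ := le_trans (norm_nonneg _) hρ
  have hw : ‖w‖ ≤ ‖r‖ * δ := by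
    rw [hw_def, norm_mul]; exact mul_le_mul_of_nonneg_left hρ (norm_nonneg _)
  have hw1 : ‖w‖ < 1 := lt_of_le_of_lt hw hqδ
  have h1w : (1 : ℂ) - w ≠ 0 := by
    intro h
    have : w = 1 := by linear_combination -h
    rw [this, norm_one] at hw1; exact lt_irrefl _ hw1
  have hbr : b - r = r⁻¹ := sub_eq_inv hr hfix
  have hbρ : b - ρ = r⁻¹ * (1 - w) := by
    have : b - ρ = (b - r) - (ρ - r) := by ring
    rw [this, hbr, hw_def]; field_simp
  have hne : b - ρ ≠ 0 := by
    rw [hbρ]; exact mul_ne_zero (inv_ne_zero hr) h1w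
  refine ⟨hne, ?_⟩
  have hexpr : (b - ρ)⁻¹ - r = r * w / (1 - w) := by
    rw [hbρ]; field_simp; ring
  rw [hexpr, norm_div, norm_mul]
  have hden : 1 - ‖w‖ ≤ ‖(1 : ℂ) - w‖ := by
    have := norm_sub_norm_le (1 : ℂ) w
    rw [norm_one] at this; linarith
  have hden_pos : 0 < 1 - ‖w‖ := by linarith
  calc ‖r‖ * ‖w‖ / ‖(1 : ℂ) - w‖ ≤ ‖r‖ * ‖w‖ / (1 - ‖w‖) := by
        apply div_le_div_of_nonneg_left (mul_nonneg (norm_nonneg _) (norm_nonneg _)) hden_pos hden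
    _ ≤ ‖r‖ * (‖r‖ * δ) / (1 - ‖r‖ * δ) := div_one_sub_mono (norm_nonneg r) hw hqδ
    _ = ‖r‖ ^ 2 * δ / (1 - ‖r‖ * δ) := by ring

/-- Containment step: under the chain condition the image disc lies inside the next disc `D(r', δ')`. -/
theorem tube_step {b r r' ρ : ℂ} {δ δ' : ℝ} (hr : r ≠ 0) (hfix : r ^ 2 - b * r + 1 = 0)
    (hρ : ‖ρ - r‖ ≤ δ) (hqδ : ‖r‖ * δ < 1)
    (hchain : ‖r - r'‖ + ‖r‖ ^ 2 * δ / (1 - ‖r‖ * δ) ≤ δ') :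
    b - ρ ≠ 0 ∧ ‖(b - ρ)⁻¹ - r'‖ ≤ δ' := by
  obtain ⟨hne, hest⟩ := mobius_step hr hfix hρ hqδ
  refine ⟨hne, ?_⟩
  calc ‖(b - ρ)⁻¹ - r'‖ = ‖((b - ρ)⁻¹ - r) + (r - r')‖ := by ring_nf
    _ ≤ ‖(b - ρ)⁻¹ - r‖ + ‖r - r'‖ := norm_add_le _ _
    _ ≤ δ' := by linarith

/-- A disc `D(r, δ)` with `‖r‖ + δ ≤ 1` lies in the closed unit disc. -/
theorem norm_le_one_of_mem_disc {r ρ : ℂ} {δ : ℝ} (hρ : ‖ρ - r‖ ≤ δ) (h : ‖r‖ + δ ≤ 1) : ‖ρ‖ ≤ 1 := by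
  calc ‖ρ‖ = ‖(ρ - r) + r‖ := by ring_nf
    _ ≤ ‖ρ - r‖ + ‖r‖ := norm_add_le _ _
    _ ≤ 1 := by linarith

/-- **Backward tube induction.**  Let `u` solve `u (k+1) - b k * u k + u (k-1) = 0` for `k₀ < k ≤ K`
(written with `k = k₀ + j + 1`), let `r k` be fixed points (`r k ^ 2 - b k * r k + 1 = 0`, `r k ≠ 0`) with radii
`δ k`, `‖r k‖ δ k < 1`, satisfying the chain condition for `k₀ < k ≤ K`, and suppose the seed: `u K ≠ 0` and
`‖u (K+1) / u K - r K‖ ≤ δ K`.  Then for every `k₀ ≤ k ≤ K`: `u k ≠ 0` and `‖u (k+1) / u k - r k‖ ≤ δ k`. -/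
theorem tube_induction (u b r : ℕ → ℂ) (δ : ℕ → ℝ) (k₀ K : ℕ) (hk : k₀ ≤ K)
    (hrec : ∀ k, k₀ < k → k ≤ K → u (k + 1) - b k * u k + u (k - 1) = 0)
    (hr : ∀ k, k₀ ≤ k → k ≤ K → r k ≠ 0)
    (hfix : ∀ k, k₀ ≤ k → k ≤ K → r k ^ 2 - b k * r k + 1 = 0)
    (hqδ : ∀ k, k₀ ≤ k → k ≤ K → ‖r k‖ * δ k < 1)
    (hchain : ∀ k, k₀ < k → k ≤ K →
      ‖r k - r (k - 1)‖ + ‖r k‖ ^ 2 * δ k / (1 - ‖r k‖ * δ k) ≤ δ (k - 1))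
    (hseed0 : u K ≠ 0) (hseed : ‖u (K + 1) / u K - r K‖ ≤ δ K) :
    ∀ k, k₀ ≤ k → k ≤ K → u k ≠ 0 ∧ ‖u (k + 1) / u k - r k‖ ≤ δ k := by
  -- downward induction on `j` with `k = K - j`
  suffices H : ∀ j, j ≤ K - k₀ → u (K - j) ≠ 0 ∧ ‖u (K - j + 1) / u (K - j) - r (K - j)‖ ≤ δ (K - j) by
    intro k hk0 hkK
    have := H (K - k) (by omega)
    rwa [show K - (K - k) = k by omega] at this
  intro j
  induction j with
  | zero => intro _; simpa using And.intro hseed0 hseed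
  | succ j ih =>
    intro hj
    obtain ⟨hne, hdisc⟩ := ih (by omega)
    -- the step from k = K - j (> k₀) down to k - 1 = K - (j+1)
    set k := K - j with hk_def
    have hk0 : k₀ < k := by omega
    have hkK : k ≤ K := by omega
    have hkm : K - (j + 1) = k - 1 := by omega
    rw [hkm]
    set ρ : ℂ := u (k + 1) / u k with hρ_def
    obtain ⟨hbρ, hest⟩ := tube_step (hr k (le_of_lt hk0) hkK) (hfix k (le_of_lt hk0) hkK) hdisc
      (hqδ k (le_of_lt hk0) hkK) (hchain k hk0 hkK)
    -- u (k-1) = (b k - ρ) * u k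
    have hukm : u (k - 1) = (b k - ρ) * u k := by
      have h := hrec k hk0 hkK
      have : u (k + 1) = ρ * u k := by rw [hρ_def]; field_simp
      rw [this] at h; linear_combination h
    have hne' : u (k - 1) ≠ 0 := by rw [hukm]; exact mul_ne_zero hbρ hne
    refine ⟨hne', ?_⟩
    have hk1 : k - 1 + 1 = k := by omega
    rw [hk1]
    have hratio : u k / u (k - 1) = (b k - ρ)⁻¹ := by
      rw [hukm]; field_simp
    rw [hratio]; exact hest

/-- Consequence: monotonicity of `‖u k‖` along the tube when every disc lies in the unit disc. -/
theorem tube_monotone (u b r : ℕ → ℂ) (δ : ℕ → ℝ) (k₀ K : ℕ) (hk : k₀ ≤ K)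
    (hrec : ∀ k, k₀ < k → k ≤ K → u (k + 1) - b k * u k + u (k - 1) = 0)
    (hr : ∀ k, k₀ ≤ k → k ≤ K → r k ≠ 0)
    (hfix : ∀ k, k₀ ≤ k → k ≤ K → r k ^ 2 - b k * r k + 1 = 0)
    (hqδ : ∀ k, k₀ ≤ k → k ≤ K → ‖r k‖ * δ k < 1)
    (hchain : ∀ k, k₀ < k → k ≤ K →
      ‖r k - r (k - 1)‖ + ‖r k‖ ^ 2 * δ k / (1 - ‖r k‖ * δ k) ≤ δ (k - 1))
    (hunit : ∀ k, k₀ ≤ k → k ≤ K → ‖r k‖ + δ k ≤ 1)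
    (hseed0 : u K ≠ 0) (hseed : ‖u (K + 1) / u K - r K‖ ≤ δ K) :
    ∀ k, k₀ ≤ k → k ≤ K → ‖u (k + 1)‖ ≤ ‖u k‖ := by
  intro k hk0 hkK
  obtain ⟨hne, hdisc⟩ := tube_induction u b r δ k₀ K hk hrec hr hfix hqδ hchain hseed0 hseed k hk0 hkK
  have h1 : ‖u (k + 1) / u k‖ ≤ 1 := norm_le_one_of_mem_disc hdisc (hunit k hk0 hkK)
  rw [norm_div, div_le_one (norm_pos_iff.mpr hne)] at h1
  exact h1

end Summit.AnomalousDissipation.SoloBlind.MobiusTube
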